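import Summits.BirchSwinnertonDyer.BirchSwinnertonDyer.Theorems.ManinLocalTwoThreeCDivisionCuspGerm
import Summits.BirchSwinnertonDyer.BirchSwinnertonDyer.Theorems.ManinLocalTwoThreeIntegralQSeriesNearCusp
import Literature.NumberTheory.EllipticCurves.KleinJIntegralQExpansion
import HarnessLib

/-!
# (N7) `CDivCuspSeries` of -an g44's `c`-DIVISION WITNESS, PROVED in the typed shape:
# `12·℘_{Λ_W}(ℰ_f)·Δ^a` (`a ≥ 2`) is an INTEGER `q`-series near `i∞`
(route `ManinLocalTwoThree`, cruxes C2 stmt-BirchSwinnertonDyer-22967 / C3 stmt-BirchSwinnertonDyer-22968; cell bsd-f2-manin, prover p3 gen 18)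

From the landed core `CDivCuspGerm.exists_hasSum_qParam_sq_mul_twelve_weierstrassP` (p752799: `𝕢²·12℘_{Λ_W}(ℰ_f) = Σ P'ₘ𝕢ᵐ`, `P' ∈ ℤ⟦q⟧`, Honda at `1`)
and `Δ = Σ (X·𝔡)ₘ 𝕢ᵐ` (`Literature.NumberTheory.EllipticCurves.hasSum_X_mul_formalDeltaUnit`, `𝔡 = formalDeltaUnit ∈ ℤ⟦q⟧`):
`12℘·Δ^a = (𝕢²·12℘)·(Δ^a/𝕢²)` and `Δ^a/𝕢² = Σ (X^{a−2}𝔡^a)ₘ 𝕢ᵐ` for `a ≥ 2` (coefficient shift), so `g := P'·X^{a−2}·𝔡^a ∈ ℤ⟦q⟧` works.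
* `hasSum_intCoeff_of_X_pow_mul` — the shift: `Σ (Xᵏ·R)ₘ qᵐ = S ⟹ Σ Rₘ qᵐ = S/qᵏ` (`q ≠ 0`);
* `cDivCuspSeries` — **(N7) in -an's typed shape** (`HOME/an/g44/CDivisionWitnessNodes-an-g44.lean` §5, def `CDivision.CDivCuspSeries`, verbatim body):
  `∀ W D a, 2 ≤ a → ∃ (g : ℚ⟦X⟧) B, (∀ n, (coeff n g).den = 1) ∧ ∀ τ, B < Im τ → Σ gₙ𝕢₁(τ)ⁿ = 12·℘_{Λ_W}(ℰ_f τ)·Δ(τ)^a`.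
Once the typed node file lands, `theorem … : CDivision.CDivCuspSeries := cDivCuspSeries` closes N7 by name.
HONEST FRAMING: one node of seven; the witness law, C2/C3, Manin's conjecture and BSD are NOT proved here.  No definitions, no sorry.
[cite: Honda1970, Thm. 9] [cite: SilvermanAEC2009, IV.1] [cite: Cox2013, §11.A Thm. 11.8]
-/

set_option autoImplicit false
-- lint-debt: the directory name repeats the summit name (sibling precedent `ManinLocalTwoThreeCDivisionCuspGerm.lean`)
set_option linter.dupNamespace false

noncomputable section

open scoped Topology PeriodPair MatrixGroups
open Complex Filter PowerSeries CongruenceSubgroup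
open UpperHalfPlane hiding I
open WeierstrassCurve Literature.NumberTheory.EllipticCurves Literature.NumberTheory.EllipticCurves.ModularForms
open Summit.BirchSwinnertonDyer.BirchSwinnertonDyer.Theorems.ManinLocalTwoThree.KummerCubeAnalytic

namespace Summit.BirchSwinnertonDyer.BirchSwinnertonDyer.Theorems.ManinLocalTwoThree.CDivCuspGerm

/-! ## §4 Bookkeeping: shift and product of integer `q`-series -/

/-- Coefficients of the `ℂ`-image of an integer series. [folklore] -/
theorem coeff_map_intCast (A : ℤ⟦X⟧) (m : ℕ) : coeff m (A.map (Int.castRingHom ℂ)) = ((coeff m A : ℤ) : ℂ) := by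
  rw [coeff_map]; rfl

/-- **Shift**: `Σ (Xᵏ·R)ₘ qᵐ = S` with `q ≠ 0` gives `Σ Rₘ qᵐ = S/qᵏ`. [folklore] -/
theorem hasSum_intCoeff_of_X_pow_mul {R : ℤ⟦X⟧} {q S : ℂ} (hq : q ≠ 0) (k : ℕ)
    (h : HasSum (fun m : ℕ ↦ ((coeff m (X ^ k * R) : ℤ) : ℂ) * q ^ m) S) :
    HasSum (fun m : ℕ ↦ ((coeff m R : ℤ) : ℂ) * q ^ m) (S / q ^ k) := by
  have h1 := (hasSum_nat_add_iff' k).mpr h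
  have hzero : ∑ i ∈ Finset.range k, ((coeff i (X ^ k * R) : ℤ) : ℂ) * q ^ i = 0 := by
    refine Finset.sum_eq_zero fun i hi ↦ ?_
    rw [Finset.mem_range] at hi
    rw [PowerSeries.coeff_X_pow_mul', if_neg (not_le.mpr hi), Int.cast_zero, zero_mul]
  rw [hzero, sub_zero] at h1
  have hfun : (fun m : ℕ ↦ ((coeff (m + k) (X ^ k * R) : ℤ) : ℂ) * q ^ (m + k)) =
      fun m : ℕ ↦ q ^ k * (((coeff m R : ℤ) : ℂ) * q ^ m) := by
    funext m
    rw [PowerSeries.coeff_X_pow_mul', if_pos (Nat.le_add_left k m), Nat.add_sub_cancel, pow_add]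
    ring
  rw [hfun] at h1
  have h2 := h1.mul_left (q ^ k)⁻¹
  have hqk : q ^ k ≠ 0 := pow_ne_zero k hq
  simp only [← mul_assoc, inv_mul_cancel₀ hqk, one_mul] at h2
  rwa [div_eq_inv_mul]

/-- **Product** of two integer `q`-series (Cauchy product, absolute convergence in `ℂ`). [folklore] -/
theorem hasSum_intCoeff_mul {A B : ℤ⟦X⟧} {q x y : ℂ}
    (hA : HasSum (fun m : ℕ ↦ ((coeff m A : ℤ) : ℂ) * q ^ m) x) (hB : HasSum (fun m : ℕ ↦ ((coeff m B : ℤ) : ℂ) * q ^ m) y) :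
    HasSum (fun m : ℕ ↦ ((coeff m (A * B) : ℤ) : ℂ) * q ^ m) (x * y) := by
  have hA' : HasSum (fun m : ℕ ↦ coeff m (A.map (Int.castRingHom ℂ)) * q ^ m) x := by
    simpa only [coeff_map_intCast] using hA
  have hB' : HasSum (fun m : ℕ ↦ coeff m (B.map (Int.castRingHom ℂ)) * q ^ m) y := by
    simpa only [coeff_map_intCast] using hB
  simpa only [coeff_map_intCast] using IntegralQSeries.hasSum_intSeries_mul hA' hB'

/-- **Powers** of an integer `q`-series. [folklore] -/
theorem hasSum_intCoeff_pow {A : ℤ⟦X⟧} {q x : ℂ} (hA : HasSum (fun m : ℕ ↦ ((coeff m A : ℤ) : ℂ) * q ^ m) x) (k : ℕ) :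
    HasSum (fun m : ℕ ↦ ((coeff m (A ^ k) : ℤ) : ℂ) * q ^ m) (x ^ k) := by
  have hA' : HasSum (fun m : ℕ ↦ coeff m (A.map (Int.castRingHom ℂ)) * q ^ m) x := by
    simpa only [coeff_map_intCast] using hA
  simpa only [coeff_map_intCast] using IntegralQSeries.hasSum_intSeries_pow hA' k

/-! ## §5 (N7) in the typed shape -/

/-- **(N7) `CDivCuspSeries` — PROVED.**  For `a ≥ 2` there are `g ∈ ℚ⟦X⟧` with all denominators `1` and `B` with
`Σ gₙ 𝕢₁(τ)ⁿ = 12·℘_{Λ_W}(ℰ_f τ)·Δ(τ)^a` for `Im τ > B` (`g = P'·X^{a−2}·𝔡^a`: Honda at `1` for `𝕢²·12℘`, `Δ = q∏(1−qⁿ)²⁴`).  Verbatim the body of -an g44's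
typed node `CDivision.CDivCuspSeries`. [cite: Honda1970, Thm. 9] [cite: SilvermanAEC2009, IV.1] [cite: Cox2013, §11.A Thm. 11.8] -/
theorem cDivCuspSeries : ∀ (W : WeierstrassCurve ℚ) [W.IsElliptic] [W.IsGloballyMinimal] {N : ℕ} [NeZero N]
    (D : ModularParametrizationData W N) (a : ℕ), 2 ≤ a →
    ∃ (g : ℚ⟦X⟧) (B : ℝ), (∀ n, (coeff n g).den = 1) ∧
      ∀ τ : ℍ, B < τ.im → HasSum (fun n : ℕ ↦ ((coeff n g : ℚ) : ℂ) * Function.Periodic.qParam 1 (τ : ℂ) ^ n)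
        ((12 : ℂ) * ℘[D.L] (eichlerIntegral D.f τ) * ModularForm.discriminant τ ^ a) := by
  intro W _ _ N _ D a ha
  classical
  obtain ⟨P, B, hP⟩ := exists_hasSum_qParam_sq_mul_twelve_weierstrassP W D
  set R : ℤ⟦X⟧ := X ^ (a - 2) * formalDeltaUnit ^ a with hR
  refine ⟨(P * R).map (Int.castRingHom ℚ), B, fun n ↦ ?_, fun τ hτ ↦ ?_⟩
  · rw [coeff_map]
    exact Rat.den_intCast _
  set q := Function.Periodic.qParam 1 (τ : ℂ) with hq
  have hq0 : q ≠ 0 := Function.Periodic.qParam_ne_zero _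
  -- `Δ^a = Σ ((X𝔡)^a)ₘ qᵐ = Σ (X²·R)ₘ qᵐ`
  have hΔ : HasSum (fun m : ℕ ↦ ((coeff m (X * formalDeltaUnit) : ℤ) : ℂ) * q ^ m) (ModularForm.discriminant τ) :=
    Literature.NumberTheory.EllipticCurves.hasSum_X_mul_formalDeltaUnit τ
  have hΔa := hasSum_intCoeff_pow hΔ a
  have hXR : (X * formalDeltaUnit : ℤ⟦X⟧) ^ a = X ^ 2 * R := by
    rw [hR, mul_pow, ← mul_assoc, ← pow_add, Nat.add_sub_cancel' ha]
  rw [hXR] at hΔa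
  have hRsum := hasSum_intCoeff_of_X_pow_mul hq0 2 hΔa
  -- the product
  have hprod := hasSum_intCoeff_mul (hP τ hτ) hRsum
  have hval : q ^ 2 * (12 * ℘[D.L] (eichlerIntegral D.f τ)) * (ModularForm.discriminant τ ^ a / q ^ 2) =
      (12 : ℂ) * ℘[D.L] (eichlerIntegral D.f τ) * ModularForm.discriminant τ ^ a := by
    field_simp
  rw [hval] at hprod
  convert hprod using 2 with n
  rw [coeff_map, hq]
  simp

end Summit.BirchSwinnertonDyer.BirchSwinnertonDyer.Theorems.ManinLocalTwoThree.CDivCuspGerm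

end
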